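import Literature.MathematicalPhysics.QuantumFieldTheory.Balaban1983to89.B8Prop5UniqKLevelBPer
import Literature.MathematicalPhysics.QuantumFieldTheory.Balaban1983to89.B8Prop5ContractionKLevelSrcPer

/-!
# `Balaban1983to89.B8Prop5UniqKLevelBSrcPer` — [Balaban1985RegularSpaces] Prop. 5, THE UNIQUENESS CLAUSE (1.109) AT `k` LEVELS ON THE TORUS (§3 p. 98) AT
# THEOREM 8's SOURCED GAUGE CONDITION (1.146) p. 101: `B8Prop5UniqKLevelBPer` (t2s-1's periodic converse-of-the-JOIN engine, [4]'s laws read at periodic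
# arguments only) RE-RUN on the periodic SOURCED contraction `B8Prop5ContractionKLevelSrcPer` (`W ↦ W − f`, `f` periodic) — the engine behind the nested
# server's instance (ii) of the N05 knit's socket `SP5u` (IR B8-P5-NESTED-SERVER)

statement-level skeleton of published theorems with citation tags; proofs where landed; nothing here is a claim about the
Yang–Mills mass gap

T. Bałaban, *Spaces of regular gauge field configurations on a lattice and gauge fixing conditions*, Commun. Math. Phys. **99** (1985) 75–102
`[Balaban1985RegularSpaces]` ("B8"; journal page = PDF page + 74): Prop. 5 (1.107)–(1.109) p. 94, (1.93)–(1.100) pp. 92–93, (1.79) p. 90, (1.113)–(1.114)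
p. 95, Thm 8 (1.146) p. 101 («there exists exactly one gauge transformation u …»), §3 p. 98 (the torus).
T. Bałaban, *Propagators for lattice gauge theories in a background field*, CMP **99** (1985) 389–434 `[Balaban1985BackgroundPropagators]` ([4]): Thm 3.1
p. 397, (3.25) p. 394.  STATUS: published, refereed.

CITATION HEADER (lean-in-tree rule).  Cell `lit-balaban`, seat `lit-balaban-p21` (gen 39), IR B8-P5-NESTED-SERVER (pub-ymgap dag-n05-c), instance (ii)
(Theorem 8's source), engine E1 of the periodic × sourced stack E0 `B8Prop5ContractionKLevelSrcPer` → E1 (this file) → E2 `B8Prop5UniqSectEWSrcPer`.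
WHAT IS PROVED (0 sorry, no `def`): ★ `isFixedPoint_of_cond146_bdd_per`, ★ `hFP_unique_of_cond146_bdd_per` — `B8Prop5UniqKLevelBPer.isFixedPoint_of_cond179_bdd_per ∕
hFP_unique_of_cond179_bdd_per` VERBATIM with dag-n05-d's `B8Prop5UniqKLevelBSrc` diff applied token for token: the candidates obey THE MULTIPLIER FORM OF
(1.146) `Δ↾Ω₀[D*A + Δλ′ + 𝔑(λ′) − f] = Q′ᵀμ` (level-periodic `μ`), the Neumann datum is `W₀ − f` with windows at `h₂ + m_f∕2`, the source `f` is a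
fixed PERIODIC function with finite `|f|₍₋₂₎` (periodicity of `f` keeps the D*-identity's right side `N` periodic, so [4]'s left-inverse law (U1) —
assumed at PERIODIC bounded functions only, RULING #4 — still applies at `N`), and the ∃! is `B8Prop5ContractionKLevelSrcPer.propFive_fixedPoint_kLevel_src_per`.
Everything else as in the Per file: (U2) `c_left'` at level-periodic multipliers, periodic `U₀`, `A`, `𝔄` level-periodic-valued, `G′` periodic-valued,
every `H_c`-hypothesis and the converse (1.114) `h114q` at periodic `λ` only, the inverse change of variables `B8Prop5UniqKLevelPer.sectE_inverse_kLevel_per`,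
`R N = 0` by `B8Prop5UniqKLevelBPer.proj325_eq_zero_of_multiplier_guarded₂`.

HONEST SCOPE.  A re-run with one additive term; verbatim re-threads; [4], Sect. E, the contraction NOT proved beyond the composition (displayed); the
periodic-multiplier premise is an extra hypothesis relative to print (on the torus a level-periodic representative exists by `Q′Q′ᵀ = c·1`; not derived
here); count-neutral; N05 ∕ `stub_PV3A` NOT discharged; one finite `T⁴` programme at fixed `ε`, Bałaban as printed — nothing continuum ∕ ℝ⁴ ∕ OS ∕
mass-gap ∕ Clay — the Yang–Mills mass gap is NOT proved.  No `sorry`, no `def`, no `… : Prop` fact, no `instance`, no `notation`.  Unit `lit-balaban-p21`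
(g39), 2026-08-28.

[cite: Balaban1985RegularSpaces, Prop. 5 (1.109) p.94, (1.93)–(1.100) pp.92–93, (1.79) p.90, (1.113)–(1.114) p.95, Thm 8 (1.146) p.101, §3 p.98; Balaban1985BackgroundPropagators, Thm 3.1 p.397, (3.25) p.394]
-/

noncomputable section

namespace Literature.MathematicalPhysics.QuantumFieldTheory.Balaban1983to89.B8Prop5UniqKLevelBSrcPer

open B7Prop1Explicit (e U1)
open B7Prop2Explicit (unitaryUnits unitaryUnits_le_U1)
open B7Eq78Linearization (conjR)
open B7Eq167Flat (Cond167)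
open B8Ineq132 (covDerivFwd covDeriv norm_conjR)
open B8Eq119TwistedAxial (Restr129)
open B8Eq138LandauZd (covLap covDivB QT covLap_zero)
open B8Eq178Averages (util178 Qnl Cond179 restr129_mul_iff_cond179)
open B8Eq182Proof (gAd)
open B8Eq184Proof (gaugeExp)
open B8Eq188Proof (frakF3 gAd_neg gAd_add)
open B8SectDSource (fixedPoint_closedBall)
open B8LambdaSpaceKLevel (wt wt_pos wt_nonneg lamSubK lamOf lamOf_sub norm_lamOf_le weight_mul_norm_covDerivFwd_le mkLam lamOf_mkLam
  norm_mkLam_le norm_le_iff norm_sub_le_iff covDerivFwd_add' covDerivFwd_sub')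
open B8Prop5ContractionKLevel (Bd2 Zsol Vop Wsrc PsiP5 Mc Kc mWc mWc_nonneg propFive_fixedPoint_kLevel zsol_eq bd2_zsol Vop_sub norm_Vop_le
  wt_sq_norm_Wsrc_le)
open B8Prop5GaugeParamKLevel (gpar_size gpar_grad gpar_lip norm_covDeriv_eq)
open B8Prop5KLevelLetters (dstar_rhs_eq_W_add covLap_sub)
open B8Restr129Inversion (restr129_mul_iff_inv_mul)
open B8Eq195Linear (proj325_sub)
open B8Prop5JoinHFP (covLap_neg')
open B8Prop5UniqKLevel (sectE_inverse_kLevel bd2_covLap_lamOf neumann_injective)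
open B8Prop5UniqKLevelPer (sectE_inverse_kLevel_per)
open B8Prop5GaugeParamKLevelPer (gpar_size_at gpar_grad_at gpar_lip_at)
open B8Prop5ContractionKLevelSrc (PsiP5src mWc_add_half)
open B8Prop5ContractionKLevelSrcPer (propFive_fixedPoint_kLevel_src_per)
open B8Prop5UniqKLevelBPer (proj325_eq_zero_of_multiplier_guarded₂)
open B8Prop5NeumannPeriodic (covDivB_per frakF3_per)

-- `Site` alone could resolve to the torus sites of `Setup.lean`; re-export the `ℤ^d` sites of `B7Prop1Explicit`.
export B7Prop1Explicit (Site)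

variable {d : ℕ} {𝔸 : Type*} [CStarAlgebra 𝔸] [Nontrivial 𝔸]

/-! ## The converse of the sourced JOIN-B and (1.109) at the sourced gauge condition, on the torus -/

section Converse146B

variable {L k : ℕ} {η : ℝ} {Ω Λs : ℕ → Set (Site d)} {Eb : ℕ → Set (Site d × Fin d)} {U₀ : Site d → Fin d → 𝔸ˣ}
  {A : Site d → Fin d → 𝔸} {u₁ : Site d → 𝔸ˣ}

/-- ★ **THE CONVERSE OF THE SOURCED JOIN ON THE TORUS** — `B8Prop5UniqKLevelBPer.isFixedPoint_of_cond179_bdd_per` ((U1) at periodic bounded x, (U2) at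
level-periodic φ; periodic competitor with level-periodic multiplier; `λ_t` periodic) VERBATIM for Theorem 8's gauge condition (1.146): the candidate obeys
the multiplier form `Δ↾Ω₀[D*A + Δλ′ + 𝔑(λ′) − f] = Q′ᵀμ`, the source `f` is a fixed PERIODIC function with finite `|f|₍₋₂₎`, and the conclusion is a fixed
point of the SOURCED contraction `λ_t = G′(Ψ_f λ_t)` (`B8Prop5ContractionKLevelSrc.PsiP5src`, `W ↦ W − f`).
[cite: Balaban1985RegularSpaces, Prop. 5 (1.107)–(1.109) p.94, (1.93)–(1.100) pp.92–93, (1.79) p.90, (1.113)–(1.114) p.95, Thm 8 (1.146) p.101, §3 p.98; Balaban1985BackgroundPropagators, Thm 3.1 p.397, (3.25) p.394] -/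
theorem isFixedPoint_of_cond146_bdd_per (hL : 1 ≤ L) (hη : 0 < η) (hU₀ : ∀ x κ, U₀ x κ ∈ unitaryUnits 𝔸) (P : ℤ) (hΩ0 : Ω 0 = Set.univ)
    (hEbΩ : ∀ j, j ≤ k → ∀ x ∈ Ω j, ∀ μ : Fin d, (x, μ) ∈ Eb j ∧ (x - e μ, μ) ∈ Eb j)
    -- letters of [4]
    (g Δ : (Site d → 𝔸) →ₗ[ℂ] (Site d → 𝔸)) (q : (Site d → 𝔸) →ₗ[ℂ] (ℕ → Site d → 𝔸)) (qs : (ℕ → Site d → 𝔸) →ₗ[ℂ] (Site d → 𝔸))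
    (Aw c : (ℕ → Site d → 𝔸) →ₗ[ℂ] (ℕ → Site d → 𝔸))
    (g_leftB : ∀ x : Site d → 𝔸, (∀ (z : Site d) (i : Fin d), x (z + P • e i) = x z) → (∃ C : ℝ, ∀ y, ‖x y‖ ≤ C) → g (Δ x + qs (Aw (q x))) = x)
    (c_left' : ∀ φ : ℕ → Site d → 𝔸, (∀ j, j ≤ k → ∀ (y : Site d) (i : Fin d), φ j (y + (P / (L : ℤ) ^ j) • e i) = φ j y) → qs (c (q (g (g (qs φ))))) = qs φ)
    (hΔ : ∀ (f : Site d → 𝔸), ∀ x ∈ Ω 0, Δ f x = covLap η U₀ ((Ω 0).indicator f) x)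
    (hqs : ∀ (μ : ℕ → Site d → 𝔸), ∀ x ∈ Ω 0, qs μ x = QT L k Λs U₀ μ x)
    -- the torus: periodic background and bond field, `𝔄` level-periodic-valued, `G′` periodic-valued
    (hU₀per : ∀ (z : Site d) (i : Fin d), U₀ (z + P • e i) = U₀ z) (hAper : ∀ (z : Site d) (i : Fin d), A (z + P • e i) = A z)
    (hAw_per : ∀ μ : ℕ → Site d → 𝔸, (∀ j, j ≤ k → ∀ (y : Site d) (i : Fin d), Aw μ j (y + (P / (L : ℤ) ^ j) • e i) = Aw μ j y))
    -- the Sect. E correction `H_c` (λ′ = λ + H_c λ) and the windows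
    (Hc : (Site d → 𝔸) → (Site d → 𝔸))
    {α₄ BR h₀ h₁ h₂ l₀ l₁ cA cDA ρ : ℝ}
    (hBR : 0 ≤ BR) (hh₀ : 0 ≤ h₀) (hh₂ : 0 ≤ h₂) (hcA : 0 ≤ cA) (hcA' : cA ≤ 1 / 13) (hcDA : 0 ≤ cDA)
    (ha₁' : α₄ / 4 + h₀ ≤ 1 / 24) (hb₁' : α₄ / 4 + h₁ ≤ 1 / 140) (hb₁ : 0 < α₄ / 4 + h₁) (hθ : 10 * (α₄ / 4 + h₀) * BR ≤ 1 / 2)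
    (hl₀' : l₀ ≤ 1 / 2) (hl₁' : l₁ ≤ 1 / 2) (hρ₀ : ρ + h₀ ≤ α₄ / 4) (hρ₁ : ρ + h₁ ≤ α₄ / 4)
    -- (1.98)R
    (hRbd : ∀ (f : Site d → 𝔸) (m : ℝ), 0 ≤ m → Bd2 L η k Ω f m → Bd2 L η k Ω (f - g (qs (c (q (g f))))) (BR * m))
    -- the binders of `H_c`
    (hc0 : ∀ s : lamSubK η U₀ L k Eb, (∀ (z : Site d) (i : Fin d), lamOf s (z + P • e i) = lamOf s z) → ‖s‖ ≤ α₄ / 4 →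
      ∀ x, ‖Hc (lamOf s) x‖ ≤ h₀)
    (hc1 : ∀ s : lamSubK η U₀ L k Eb, (∀ (z : Site d) (i : Fin d), lamOf s (z + P • e i) = lamOf s z) → ‖s‖ ≤ α₄ / 4 →
      ∀ j, j ≤ k → ∀ p ∈ Eb j, wt L η j * ‖covDerivFwd η U₀ p.2 (Hc (lamOf s)) p.1‖ ≤ h₁)
    (hc2 : ∀ s : lamSubK η U₀ L k Eb, (∀ (z : Site d) (i : Fin d), lamOf s (z + P • e i) = lamOf s z) → ‖s‖ ≤ α₄ / 4 →
      Bd2 L η k Ω (covLap η U₀ (Hc (lamOf s))) h₂)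
    (hcL0 : ∀ s t : lamSubK η U₀ L k Eb, (∀ (z : Site d) (i : Fin d), lamOf s (z + P • e i) = lamOf s z) → (∀ (z : Site d) (i : Fin d), lamOf t (z + P • e i) = lamOf t z) →
      ‖s‖ ≤ α₄ / 4 → ‖t‖ ≤ α₄ / 4 → ∀ x, ‖Hc (lamOf s) x - Hc (lamOf t) x‖ ≤ l₀ * ‖s - t‖)
    (hcL1 : ∀ s t : lamSubK η U₀ L k Eb, (∀ (z : Site d) (i : Fin d), lamOf s (z + P • e i) = lamOf s z) → (∀ (z : Site d) (i : Fin d), lamOf t (z + P • e i) = lamOf t z) →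
      ‖s‖ ≤ α₄ / 4 → ‖t‖ ≤ α₄ / 4 → ∀ j, j ≤ k → ∀ p ∈ Eb j,
      wt L η j * ‖covDerivFwd η U₀ p.2 (Hc (lamOf s) - Hc (lamOf t)) p.1‖ ≤ l₁ * ‖s - t‖)
    (hcper : ∀ s : lamSubK η U₀ L k Eb, (∀ (z : Site d) (i : Fin d), lamOf s (z + P • e i) = lamOf s z) → ‖s‖ ≤ α₄ / 4 →
      ∀ (z : Site d) (i : Fin d), Hc (lamOf s) (z + P • e i) = Hc (lamOf s) z)
    -- the datum and THE SOURCE `f` (periodic, finite `|f|₍₋₂₎` on the `Ω_j`)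
    (hDA : Bd2 L η k Ω (fun y => covDivB η U₀ A y) cDA) {f : Site d → 𝔸} {mf : ℝ} (hmf : 0 ≤ mf) (hf : Bd2 L η k Ω f mf)
    (hfper : ∀ (z : Site d) (i : Fin d), f (z + P • e i) = f z)
    (hA : ∀ j, j ≤ k → ∀ x ∈ Ω j, ∀ μ : Fin d,
      wt L η j * ‖A x μ‖ ≤ cA ∧ wt L η j * ‖conjR (U₀ (x - e μ) μ)⁻¹ (A (x - e μ) μ)‖ ≤ cA)
    -- Sect. E (1.114) in its converse printed use
    (h114q : ∀ s : lamSubK η U₀ L k Eb, (∀ (z : Site d) (i : Fin d), lamOf s (z + P • e i) = lamOf s z) → ‖s‖ ≤ α₄ / 4 →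
      Cond179 L k Λs U₀ (gaugeExp (lamOf s + Hc (lamOf s)))⁻¹ u₁⁻¹ → q (lamOf s) = 0)
    -- the candidate solution
    {lam : Site d → 𝔸} (hlper : (∀ (z : Site d) (i : Fin d), lam (z + P • e i) = lam z)) (hlρ : ∀ x, ‖lam x‖ ≤ ρ)
    (hDρ : ∀ j, j ≤ k → ∀ p ∈ Eb j, wt L η j * ‖covDerivFwd η U₀ p.2 lam p.1‖ ≤ ρ)
    (hmult : ∃ μ : ℕ → Site d → 𝔸, (∀ j, j ≤ k → ∀ (y : Site d) (i : Fin d), μ j (y + (P / (L : ℤ) ^ j) • e i) = μ j y) ∧ ∀ x ∈ Ω 0,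
      covLap η U₀ ((Ω 0).indicator fun y => covDivB η U₀ A y + covLap η U₀ lam y +
        ((conjR (gaugeExp lam y)⁻¹ (covDivB η U₀ A y) - covDivB η U₀ A y) +
          (gAd (covLap η U₀ lam y) (lam y) - covLap η U₀ lam y) + ∑ μ, frakF3 η U₀ lam A y μ) - f y) x = QT L k Λs U₀ μ x)
    (h179 : Cond179 L k Λs U₀ (gaugeExp lam)⁻¹ u₁⁻¹) :
    ∃ t : lamSubK η U₀ L k Eb, (∀ (z : Site d) (i : Fin d), lamOf t (z + P • e i) = lamOf t z) ∧ ‖t‖ ≤ α₄ / 4 ∧ lamOf t + Hc (lamOf t) = lam ∧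
      lamOf t = g (PsiP5src η U₀ A (fun y => covDivB η U₀ A y) f (fun f => f - g (qs (c (q (g f)))))
        (fun l => l + Hc l) (fun l => covLap η U₀ (Hc l)) (lamOf t)) := by
  have huniv : ∀ x, x ∈ Ω 0 := fun x => by rw [hΩ0]; exact Set.mem_univ x
  -- the letter R of (1.95)
  set R : (Site d → 𝔸) → (Site d → 𝔸) := fun f => f - g (qs (c (q (g f)))) with hRdef
  have hR : ∀ f, R f = f - g (qs (c (q (g f)))) := fun f => rfl
  have hRsub : ∀ f f' : Site d → 𝔸, R (f - f') = R f - R f' := proj325_sub (R := R) hR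
  have hR0 : R 0 = 0 := by rw [hR]; simp
  have hRneg : ∀ f : Site d → 𝔸, R (-f) = -R f := fun f => by rw [← zero_sub, hRsub, hR0, zero_sub]
  have hRadd : ∀ f f' : Site d → 𝔸, R (f + f') = R f + R f' := fun f f' => by
    have h := hRsub (f + f') f'
    rw [add_sub_cancel_right] at h
    rw [h, sub_add_cancel]
  -- Step 1: the inverse change of variables
  obtain ⟨t, hpt, ht, hgp⟩ := sectE_inverse_kLevel_per hη P Hc hh₀ hl₀' hl₁' hρ₀ hρ₁ hc0 hc1 hcL0 hcL1 hcper hlper hlρ hDρ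
  -- sizes of λ′ = λ_t + H_cλ_t
  have hρ0 : 0 ≤ ρ := (norm_nonneg _).trans (hlρ 0)
  have ha12 : ∀ x, ‖lam x‖ ≤ 1 / 12 := fun x => (hlρ x).trans (by linarith)
  have hlam_a : ∀ x, ‖lam x‖ ≤ α₄ / 4 + h₀ := fun x => by rw [← hgp]; exact gpar_size_at t ht (hc0 t hpt ht) x
  have ha12' : α₄ / 4 + h₀ ≤ 1 / 12 := by linarith
  have hgrad : ∀ j, j ≤ k → ∀ x ∈ Ω j, ∀ μ : Fin d,
      wt L η j * ‖covDerivFwd η U₀ μ lam x‖ ≤ α₄ / 4 + h₁ ∧ wt L η j * ‖covDeriv η U₀ μ lam x‖ ≤ α₄ / 4 + h₁ := by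
    intro j hj x hx μ
    rw [← hgp]
    exact gpar_grad_at hη hU₀ hEbΩ t ht (hc1 t hpt ht) hj hx μ
  -- the Neumann data at λ′
  have hVsub : ∀ f f' : Site d → 𝔸, ∀ j, j ≤ k → ∀ x ∈ Ω j, Vop lam f x - Vop lam f' x = Vop lam (f - f') x :=
    fun f f' j _ x _ => Vop_sub f f' (ha12 x)
  have hVbd : ∀ f : Site d → 𝔸, ∀ j, j ≤ k → ∀ x ∈ Ω j, ‖Vop lam f x‖ ≤ 10 * (α₄ / 4 + h₀) * ‖f x‖ :=
    fun f j _ x _ => norm_Vop_le f (hlam_a x) ha12'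
  have hcV : 0 ≤ 10 * (α₄ / 4 + h₀) := by linarith
  set mW := mWc d (α₄ / 4 + h₁) cA (h₂ + mf / 2) cDA with hmWdef
  have hmW : 0 ≤ mW := mWc_nonneg hb₁.le hcA (by positivity) hcDA
  set W0 : Site d → 𝔸 := Wsrc η U₀ A (fun y => covDivB η U₀ A y) lam (covLap η U₀ (Hc (lamOf t))) with hW0def
  have hW0 : Bd2 L η k Ω W0 (mWc d (α₄ / 4 + h₁) cA h₂ cDA) := fun j hj x hx =>
    wt_sq_norm_Wsrc_le hL hη (by linarith : α₄ / 4 + h₁ ≤ 1 / 70) hcA (by linarith : cA ≤ 1 / 12) (ha12 x) (hgrad j hj x hx)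
      (hA j hj x hx) (hc2 t hpt ht j hj x hx) (hDA j hj x hx)
  -- THE SOURCED NEUMANN DATUM `W₀ − f`
  set W : Site d → 𝔸 := W0 - f with hWdef
  have hW : Bd2 L η k Ω W mW := by rw [hmWdef, ← mWc_add_half]; exact hW0.sub hf
  set Z : Site d → 𝔸 := Zsol W (Vop lam) R with hZdef
  have hZeq : ∀ j, j ≤ k → ∀ x ∈ Ω j, Z x + Vop lam (R Z) x = W x :=
    fun j hj x hx => zsol_eq hL hη hVsub hVbd hRsub hRbd hW hcV hBR hmW hθ hj hx
  have hZbd : Bd2 L η k Ω Z (2 * mW) := bd2_zsol hL hη hVsub hVbd hRsub hRbd hW hcV hBR hmW hθ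
  -- Step 2: `Q′λ_t = 0` from (1.79) for the inverse pair and (1.114)
  have hq0 : q (lamOf t) = 0 := h114q t hpt ht (by rw [hgp]; exact h179)
  -- Step 3: `R N = 0` for the right-hand side `N` of the D*-identity, from the multiplier clause
  set N : Site d → 𝔸 := fun y => covDivB η U₀ A y + covLap η U₀ lam y +
    ((conjR (gaugeExp lam y)⁻¹ (covDivB η U₀ A y) - covDivB η U₀ A y) +
      (gAd (covLap η U₀ lam y) (lam y) - covLap η U₀ lam y) + ∑ μ, frakF3 η U₀ lam A y μ) - f y with hNdef
  obtain ⟨μ, hμper, hμ⟩ := hmult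
  have hΔN : Δ N = qs μ := funext fun x => by
    rw [hΔ N x (huniv x), hqs μ x (huniv x)]
    exact hμ x (huniv x)
  -- Step 4: `N = W + (Δλ_t + V Δλ_t)` (the D*-identity's right-hand side regrouped at λ′ = λ_t − (−H_cλ_t))
  set Y : Site d → 𝔸 := covLap η U₀ (lamOf t) with hYdef
  have hdef : lam = lamOf t - (-Hc (lamOf t)) := by rw [sub_neg_eq_add, hgp]
  have hNW : N = W + (Y + Vop lam Y) := funext fun y => by
    have h := dstar_rhs_eq_W_add (η := η) U₀ A hdef (ha12 y)
    rw [covLap_neg', gAd_neg _ (ha12 y), sub_neg_eq_add] at h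
    -- `h` : the un-sourced right-hand side at `y` equals `W₀ y + (Y y + V Y y)`; subtract the source on both sides
    have h0 : N y + f y = (W0 + (Y + Vop lam Y)) y := by
      simp only [hNdef, sub_add_cancel]
      exact h
    show N y = ((W0 - f) + (Y + Vop lam Y)) y
    rw [eq_sub_of_add_eq h0]
    simp only [Pi.add_apply, Pi.sub_apply]
    abel
  -- (W8″ guard) `N` is a BOUNDED function: `Bd2`-bounded through `W`, `Δλ_t`, `VΔλ_t`, hence sup-bounded as `Ω 0 = univ`
  have hNbd2 : Bd2 L η k Ω N (mW + (2 * d * (L : ℝ) ^ k * ‖t‖ + 10 * (α₄ / 4 + h₀) * (2 * d * (L : ℝ) ^ k * ‖t‖))) := by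
    have hY : Bd2 L η k Ω Y (2 * d * (L : ℝ) ^ k * ‖t‖) := bd2_covLap_lamOf hL hη hU₀ hEbΩ t
    have hVY : Bd2 L η k Ω (Vop lam Y) (10 * (α₄ / 4 + h₀) * (2 * d * (L : ℝ) ^ k * ‖t‖)) := fun j hj x hx => by
      calc wt L η j ^ 2 * ‖Vop lam Y x‖ ≤ wt L η j ^ 2 * (10 * (α₄ / 4 + h₀) * ‖Y x‖) :=
            mul_le_mul_of_nonneg_left (hVbd Y j hj x hx) (sq_nonneg _)
        _ = 10 * (α₄ / 4 + h₀) * (wt L η j ^ 2 * ‖Y x‖) := by ring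
        _ ≤ 10 * (α₄ / 4 + h₀) * (2 * d * (L : ℝ) ^ k * ‖t‖) := mul_le_mul_of_nonneg_left (hY j hj x hx) hcV
    rw [hNW]
    exact hW.add (hY.add hVY)
  have hNbdd : ∃ C : ℝ, ∀ y, ‖N y‖ ≤ C :=
    ⟨_, fun y => hNbd2.norm_le hL hη (Nat.zero_le _) (huniv y)⟩
  -- on the torus: `N` is periodic (periodic `λ′`, `U₀`, `A` AND PERIODIC SOURCE `f`), so the guarded law applies; the multiplier argument of `C` is
  -- level-periodic
  have hNper : (∀ (z : Site d) (i : Fin d), N (z + P • e i) = N z) := by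
    intro z i
    have hF : ∀ ν : Fin d, frakF3 η U₀ lam A (z + P • e i) ν = frakF3 η U₀ lam A z ν := fun ν => frakF3_per hU₀per hAper hlper ν z i
    simp only [hNdef, gaugeExp, hlper z i, covDivB_per hU₀per hAper z i, B8Thm2TorusLettersPerConv.covLap_per hU₀per hlper z i, hF,
      hfper z i]
  have hRN : R N = 0 :=
    proj325_eq_zero_of_multiplier_guarded₂ g Δ q qs Aw c
      (P := fun x : Site d → 𝔸 => (∀ (z : Site d) (i : Fin d), x (z + P • e i) = x z) ∧ ∃ C : ℝ, ∀ y, ‖x y‖ ≤ C)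
      (PF := fun φ : ℕ → Site d → 𝔸 => (∀ j, j ≤ k → ∀ (y : Site d) (i : Fin d), φ j (y + (P / (L : ℤ) ^ j) • e i) = φ j y))
      (fun x hx => g_leftB x hx.1 hx.2) c_left' ⟨hNper, hNbdd⟩
      (fun j hj y i => by simp only [Pi.add_apply, hμper j hj y i, hAw_per _ j hj y i]) hΔN
  -- Step 5: `RΔλ_t = Δλ_t`, and the Neumann identity, give `Δλ_t = −RZ`
  have hYΔ : Y = Δ (lamOf t) := funext fun x => by
    rw [hΔ _ x (huniv x), hΩ0, Set.indicator_univ]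
  have hgY : g Y = lamOf t := by
    have h := g_leftB (lamOf t) hpt ⟨‖t‖, norm_lamOf_le t⟩
    rw [hq0, map_zero, map_zero, add_zero, ← hYΔ] at h
    exact h
  have hRY : R Y = Y := by
    rw [hR, hgY, hq0, map_zero, map_zero, map_zero, sub_zero]
  have hVadd : ∀ f f' : Site d → 𝔸, Vop lam (f + f') = Vop lam f + Vop lam f' := fun f f' => by
    funext x
    have h := Vop_sub (a := lam) (f + f') f' (ha12 x)
    rw [add_sub_cancel_right] at h
    rw [Pi.add_apply, ← h, sub_add_cancel]
  have hWfun : W = Z + Vop lam (R Z) := funext fun x => by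
    rw [Pi.add_apply]
    exact (hZeq 0 (Nat.zero_le _) x (huniv x)).symm
  set D : Site d → 𝔸 := Y + R Z with hDdef
  have hDeq : D = -R (Vop lam D) := by
    have h1 : R Z + R (Vop lam (R Z)) + (Y + R (Vop lam Y)) = 0 := by
      calc R Z + R (Vop lam (R Z)) + (Y + R (Vop lam Y)) = R N := by rw [hNW, hRadd, hRadd, hWfun, hRadd, hRY]
        _ = 0 := hRN
    have h2 : R (Vop lam D) = R (Vop lam Y) + R (Vop lam (R Z)) := by rw [hDdef, hVadd, hRadd]
    have h3 : (Y + R Z) + (R (Vop lam Y) + R (Vop lam (R Z))) = 0 := by rw [← h1]; abel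
    rw [h2]
    exact eq_neg_of_add_eq_zero_left h3
  have hDbd : Bd2 L η k Ω D (2 * d * (L : ℝ) ^ k * ‖t‖ + BR * (2 * mW)) :=
    (bd2_covLap_lamOf hL hη hU₀ hEbΩ t).add (hRbd Z (2 * mW) (by positivity) hZbd)
  have hD0 : ∀ j, j ≤ k → ∀ x ∈ Ω j, D x = 0 :=
    neumann_injective hL hη hVbd hRbd hcV (by positivity) hθ hDbd fun j _ x _ => congrFun hDeq x
  have hYRZ : Y = -R Z := funext fun x => by
    have h : Y x + R Z x = 0 := hD0 0 (Nat.zero_le _) x (huniv x)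
    rw [Pi.neg_apply]
    exact eq_neg_of_add_eq_zero_left h
  -- Step 6: the fixed-point equation (1.100): `λ_t = G′Δλ_t = G′R(−Z)`
  have hΔt : Δ (lamOf t) = R (fun x => -Z x) := by
    rw [← hYΔ, hYRZ, ← hRneg]
    rfl
  have hfix : lamOf t = g (R (fun x => -Z x)) := by
    have h := g_leftB (lamOf t) hpt ⟨‖t‖, norm_lamOf_le t⟩
    rw [hq0, map_zero, map_zero, add_zero, hΔt] at h
    exact h.symm
  refine ⟨t, hpt, ht, hgp, ?_⟩
  simp only [PsiP5src, hgp]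
  exact hfix


/-- ★ **PROPOSITION 5's UNIQUENESS CLAUSE (1.109) AT THE SOURCED GAUGE CONDITION (Theorem 8), AT `k` LEVELS, ON THE TORUS** —
`B8Prop5UniqKLevelBPer.hFP_unique_of_cond179_bdd_per` VERBATIM with the multiplier clauses of the two PERIODIC candidates carrying the (periodic) source
(`… − f`) and the ∃! taken from `B8Prop5ContractionKLevelSrcPer.propFive_fixedPoint_kLevel_src_per` (windows at `h₂ + m_f∕2`): two such candidates with
level-periodic multipliers ARE EQUAL.
[cite: Balaban1985RegularSpaces, Prop. 5 (1.109) p.94, p.94 (after (1.106)), (1.100) p.93, Thm 8 (1.146) p.101 («exactly one gauge transformation u»), §3 p.98; Balaban1985BackgroundPropagators, Thm 3.1 p.397] -/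
theorem hFP_unique_of_cond146_bdd_per (hL : 1 ≤ L) (hη : 0 < η) (hU₀ : ∀ x κ, U₀ x κ ∈ unitaryUnits 𝔸) (P : ℤ) (hΩ0 : Ω 0 = Set.univ)
    (hEbΩ : ∀ j, j ≤ k → ∀ x ∈ Ω j, ∀ μ : Fin d, (x, μ) ∈ Eb j ∧ (x - e μ, μ) ∈ Eb j)
    -- letters of [4]
    (g Δ : (Site d → 𝔸) →ₗ[ℂ] (Site d → 𝔸)) (q : (Site d → 𝔸) →ₗ[ℂ] (ℕ → Site d → 𝔸)) (qs : (ℕ → Site d → 𝔸) →ₗ[ℂ] (Site d → 𝔸))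
    (Aw c : (ℕ → Site d → 𝔸) →ₗ[ℂ] (ℕ → Site d → 𝔸))
    (g_leftB : ∀ x : Site d → 𝔸, (∀ (z : Site d) (i : Fin d), x (z + P • e i) = x z) → (∃ C : ℝ, ∀ y, ‖x y‖ ≤ C) → g (Δ x + qs (Aw (q x))) = x)
    (c_left' : ∀ φ : ℕ → Site d → 𝔸, (∀ j, j ≤ k → ∀ (y : Site d) (i : Fin d), φ j (y + (P / (L : ℤ) ^ j) • e i) = φ j y) → qs (c (q (g (g (qs φ))))) = qs φ)
    (hΔ : ∀ (f : Site d → 𝔸), ∀ x ∈ Ω 0, Δ f x = covLap η U₀ ((Ω 0).indicator f) x)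
    (hqs : ∀ (μ : ℕ → Site d → 𝔸), ∀ x ∈ Ω 0, qs μ x = QT L k Λs U₀ μ x)
    -- the torus: periodic background and bond field, `𝔄` level-periodic-valued, `G′` periodic-valued
    (hU₀per : ∀ (z : Site d) (i : Fin d), U₀ (z + P • e i) = U₀ z) (hAper : ∀ (z : Site d) (i : Fin d), A (z + P • e i) = A z)
    (hAw_per : ∀ μ : ℕ → Site d → 𝔸, (∀ j, j ≤ k → ∀ (y : Site d) (i : Fin d), Aw μ j (y + (P / (L : ℤ) ^ j) • e i) = Aw μ j y))
    -- the Sect. E correction `H_c` (λ′ = λ + H_c λ) and the windows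
    (Hc : (Site d → 𝔸) → (Site d → 𝔸))
    {α₄ BG BR h₀ h₁ h₂ l₀ l₁ l₂ cA cDA ρ : ℝ}
    (hα₄ : 0 ≤ α₄) (hBG : 0 ≤ BG) (hBR : 0 ≤ BR) (hh₀ : 0 ≤ h₀) (hh₂ : 0 ≤ h₂) (hl₀ : 0 ≤ l₀) (hl₁ : 0 ≤ l₁) (hl₂ : 0 ≤ l₂)
    (hcA : 0 ≤ cA) (hcA' : cA ≤ 1 / 13) (hcDA : 0 ≤ cDA)
    (ha₁' : α₄ / 4 + h₀ ≤ 1 / 24) (hb₁' : α₄ / 4 + h₁ ≤ 1 / 140) (hb₁ : 0 < α₄ / 4 + h₁) (hθ : 10 * (α₄ / 4 + h₀) * BR ≤ 1 / 2)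
    (hl₀' : l₀ ≤ 1 / 2) (hl₁' : l₁ ≤ 1 / 2) (hρ₀ : ρ + h₀ ≤ α₄ / 4) (hρ₁ : ρ + h₁ ≤ α₄ / 4)
    -- (1.101) for G′, (1.98)R
    (hG : ∀ (f : Site d → 𝔸) (m : ℝ), 0 ≤ m → Bd2 L η k Ω f m →
      (∀ x, ‖g f x‖ ≤ BG * m) ∧ ∀ j, j ≤ k → ∀ p ∈ Eb j, wt L η j * ‖covDerivFwd η U₀ p.2 (g f) p.1‖ ≤ BG * m)
    (hGper : ∀ (f : Site d → 𝔸) (z : Site d) (i : Fin d), g f (z + P • e i) = g f z)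
    (hRbd : ∀ (f : Site d → 𝔸) (m : ℝ), 0 ≤ m → Bd2 L η k Ω f m → Bd2 L η k Ω (f - g (qs (c (q (g f))))) (BR * m))
    -- the binders of `H_c`
    (hc0 : ∀ s : lamSubK η U₀ L k Eb, (∀ (z : Site d) (i : Fin d), lamOf s (z + P • e i) = lamOf s z) → ‖s‖ ≤ α₄ / 4 →
      ∀ x, ‖Hc (lamOf s) x‖ ≤ h₀)
    (hc1 : ∀ s : lamSubK η U₀ L k Eb, (∀ (z : Site d) (i : Fin d), lamOf s (z + P • e i) = lamOf s z) → ‖s‖ ≤ α₄ / 4 →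
      ∀ j, j ≤ k → ∀ p ∈ Eb j, wt L η j * ‖covDerivFwd η U₀ p.2 (Hc (lamOf s)) p.1‖ ≤ h₁)
    (hc2 : ∀ s : lamSubK η U₀ L k Eb, (∀ (z : Site d) (i : Fin d), lamOf s (z + P • e i) = lamOf s z) → ‖s‖ ≤ α₄ / 4 →
      Bd2 L η k Ω (covLap η U₀ (Hc (lamOf s))) h₂)
    (hcL0 : ∀ s t : lamSubK η U₀ L k Eb, (∀ (z : Site d) (i : Fin d), lamOf s (z + P • e i) = lamOf s z) → (∀ (z : Site d) (i : Fin d), lamOf t (z + P • e i) = lamOf t z) →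
      ‖s‖ ≤ α₄ / 4 → ‖t‖ ≤ α₄ / 4 → ∀ x, ‖Hc (lamOf s) x - Hc (lamOf t) x‖ ≤ l₀ * ‖s - t‖)
    (hcL1 : ∀ s t : lamSubK η U₀ L k Eb, (∀ (z : Site d) (i : Fin d), lamOf s (z + P • e i) = lamOf s z) → (∀ (z : Site d) (i : Fin d), lamOf t (z + P • e i) = lamOf t z) →
      ‖s‖ ≤ α₄ / 4 → ‖t‖ ≤ α₄ / 4 → ∀ j, j ≤ k → ∀ p ∈ Eb j,
      wt L η j * ‖covDerivFwd η U₀ p.2 (Hc (lamOf s) - Hc (lamOf t)) p.1‖ ≤ l₁ * ‖s - t‖)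
    (hcper : ∀ s : lamSubK η U₀ L k Eb, (∀ (z : Site d) (i : Fin d), lamOf s (z + P • e i) = lamOf s z) → ‖s‖ ≤ α₄ / 4 →
      ∀ (z : Site d) (i : Fin d), Hc (lamOf s) (z + P • e i) = Hc (lamOf s) z)
    (hcL2 : ∀ s t : lamSubK η U₀ L k Eb, (∀ (z : Site d) (i : Fin d), lamOf s (z + P • e i) = lamOf s z) → (∀ (z : Site d) (i : Fin d), lamOf t (z + P • e i) = lamOf t z) →
      ‖s‖ ≤ α₄ / 4 → ‖t‖ ≤ α₄ / 4 → Bd2 L η k Ω (covLap η U₀ (Hc (lamOf s)) - covLap η U₀ (Hc (lamOf t))) (l₂ * ‖s - t‖))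
    -- the datum and THE SOURCE `f` (periodic, finite `|f|₍₋₂₎` on the `Ω_j`)
    (hDA : Bd2 L η k Ω (fun y => covDivB η U₀ A y) cDA) {f : Site d → 𝔸} {mf : ℝ} (hmf : 0 ≤ mf) (hf : Bd2 L η k Ω f mf)
    (hfper : ∀ (z : Site d) (i : Fin d), f (z + P • e i) = f z)
    (hA : ∀ j, j ≤ k → ∀ x ∈ Ω j, ∀ μ : Fin d,
      wt L η j * ‖A x μ‖ ≤ cA ∧ wt L η j * ‖conjR (U₀ (x - e μ) μ)⁻¹ (A (x - e μ) μ)‖ ≤ cA)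
    -- smallness (1.103)/(1.106)
    (h103 : BG * Mc d BR (α₄ / 4 + h₁) cA (h₂ + mf / 2) cDA ≤ α₄ / 4)
    (h106 : BG * Kc d BR (α₄ / 4 + h₁) cA (h₂ + mf / 2) cDA l₂ (1 + l₀) (1 + l₁) ≤ 1 / 2)
    -- Sect. E (1.114) in its converse printed use
    (h114q : ∀ s : lamSubK η U₀ L k Eb, (∀ (z : Site d) (i : Fin d), lamOf s (z + P • e i) = lamOf s z) → ‖s‖ ≤ α₄ / 4 →
      Cond179 L k Λs U₀ (gaugeExp (lamOf s + Hc (lamOf s)))⁻¹ u₁⁻¹ → q (lamOf s) = 0)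
    -- the two solutions
    {lam₁ lam₂ : Site d → 𝔸}
    (hl₁per : (∀ (z : Site d) (i : Fin d), lam₁ (z + P • e i) = lam₁ z)) (hl₁ : ∀ x, ‖lam₁ x‖ ≤ ρ) (hD₁ : ∀ j, j ≤ k → ∀ p ∈ Eb j, wt L η j * ‖covDerivFwd η U₀ p.2 lam₁ p.1‖ ≤ ρ)
    (hmult₁ : ∃ μ : ℕ → Site d → 𝔸, (∀ j, j ≤ k → ∀ (y : Site d) (i : Fin d), μ j (y + (P / (L : ℤ) ^ j) • e i) = μ j y) ∧ ∀ x ∈ Ω 0,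
      covLap η U₀ ((Ω 0).indicator fun y => covDivB η U₀ A y + covLap η U₀ lam₁ y +
        ((conjR (gaugeExp lam₁ y)⁻¹ (covDivB η U₀ A y) - covDivB η U₀ A y) +
          (gAd (covLap η U₀ lam₁ y) (lam₁ y) - covLap η U₀ lam₁ y) + ∑ μ, frakF3 η U₀ lam₁ A y μ) - f y) x = QT L k Λs U₀ μ x)
    (h179₁ : Cond179 L k Λs U₀ (gaugeExp lam₁)⁻¹ u₁⁻¹)
    (hl₂per : (∀ (z : Site d) (i : Fin d), lam₂ (z + P • e i) = lam₂ z)) (hl₂' : ∀ x, ‖lam₂ x‖ ≤ ρ) (hD₂ : ∀ j, j ≤ k → ∀ p ∈ Eb j, wt L η j * ‖covDerivFwd η U₀ p.2 lam₂ p.1‖ ≤ ρ)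
    (hmult₂ : ∃ μ : ℕ → Site d → 𝔸, (∀ j, j ≤ k → ∀ (y : Site d) (i : Fin d), μ j (y + (P / (L : ℤ) ^ j) • e i) = μ j y) ∧ ∀ x ∈ Ω 0,
      covLap η U₀ ((Ω 0).indicator fun y => covDivB η U₀ A y + covLap η U₀ lam₂ y +
        ((conjR (gaugeExp lam₂ y)⁻¹ (covDivB η U₀ A y) - covDivB η U₀ A y) +
          (gAd (covLap η U₀ lam₂ y) (lam₂ y) - covLap η U₀ lam₂ y) + ∑ μ, frakF3 η U₀ lam₂ A y μ) - f y) x = QT L k Λs U₀ μ x)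
    (h179₂ : Cond179 L k Λs U₀ (gaugeExp lam₂)⁻¹ u₁⁻¹) :
    lam₁ = lam₂ := by
  obtain ⟨t₁, hpt₁, ht₁, hgp₁, hfix₁⟩ := isFixedPoint_of_cond146_bdd_per hL hη hU₀ P hΩ0 hEbΩ g Δ q qs Aw c g_leftB c_left' hΔ hqs hU₀per
    hAper hAw_per Hc hBR hh₀ hh₂ hcA hcA' hcDA ha₁' hb₁' hb₁ hθ hl₀' hl₁' hρ₀ hρ₁ hRbd hc0 hc1 hc2 hcL0 hcL1 hcper hDA hmf hf hfper hA h114q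
    hl₁per hl₁ hD₁ hmult₁ h179₁
  obtain ⟨t₂, hpt₂, ht₂, hgp₂, hfix₂⟩ := isFixedPoint_of_cond146_bdd_per hL hη hU₀ P hΩ0 hEbΩ g Δ q qs Aw c g_leftB c_left' hΔ hqs hU₀per
    hAper hAw_per Hc hBR hh₀ hh₂ hcA hcA' hcDA ha₁' hb₁' hb₁ hθ hl₀' hl₁' hρ₀ hρ₁ hRbd hc0 hc1 hc2 hcL0 hcL1 hcper hDA hmf hf hfper hA h114q
    hl₂per hl₂' hD₂ hmult₂ h179₂
  -- the letter R and the displayed maps of the contraction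
  set R : (Site d → 𝔸) → (Site d → 𝔸) := fun f => f - g (qs (c (q (g f)))) with hRdef
  have hR : ∀ f, R f = f - g (qs (c (q (g f)))) := fun f => rfl
  have hRsub : ∀ f f' : Site d → 𝔸, R (f - f') = R f - R f' := proj325_sub (R := R) hR
  set gpar : (Site d → 𝔸) → (Site d → 𝔸) := fun lam => lam + Hc lam with hgpar
  set Eterm : (Site d → 𝔸) → (Site d → 𝔸) := fun lam => covLap η U₀ (Hc lam) with hEterm
  have hg0 : ∀ s : lamSubK η U₀ L k Eb, (∀ (z : Site d) (i : Fin d), lamOf s (z + P • e i) = lamOf s z) → ‖s‖ ≤ α₄ / 4 →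
      ∀ j, j ≤ k → ∀ x ∈ Ω j, ‖gpar (lamOf s) x‖ ≤ α₄ / 4 + h₀ :=
    fun s hp hs j _ x _ => gpar_size_at s hs (hc0 s hp hs) x
  have hg1 : ∀ s : lamSubK η U₀ L k Eb, (∀ (z : Site d) (i : Fin d), lamOf s (z + P • e i) = lamOf s z) → ‖s‖ ≤ α₄ / 4 → ∀ j, j ≤ k → ∀ x ∈ Ω j, ∀ μ : Fin d,
      wt L η j * ‖covDerivFwd η U₀ μ (gpar (lamOf s)) x‖ ≤ α₄ / 4 + h₁ ∧ wt L η j * ‖covDeriv η U₀ μ (gpar (lamOf s)) x‖ ≤ α₄ / 4 + h₁ :=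
    fun s hp hs j hj x hx μ => gpar_grad_at hη hU₀ hEbΩ s hs (hc1 s hp hs) hj hx μ
  have hgL : ∀ s t : lamSubK η U₀ L k Eb, (∀ (z : Site d) (i : Fin d), lamOf s (z + P • e i) = lamOf s z) → (∀ (z : Site d) (i : Fin d), lamOf t (z + P • e i) = lamOf t z) →
      ‖s‖ ≤ α₄ / 4 → ‖t‖ ≤ α₄ / 4 → ∀ j, j ≤ k → ∀ x ∈ Ω j,
      ‖gpar (lamOf s) x - gpar (lamOf t) x‖ ≤ (1 + l₀) * ‖s - t‖ ∧ ∀ μ : Fin d,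
        wt L η j * ‖covDerivFwd η U₀ μ (gpar (lamOf s) - gpar (lamOf t)) x‖ ≤ (1 + l₁) * ‖s - t‖ ∧
        wt L η j * ‖covDeriv η U₀ μ (gpar (lamOf s) - gpar (lamOf t)) x‖ ≤ (1 + l₁) * ‖s - t‖ :=
    fun s t hps hpt hs ht j hj x hx => gpar_lip_at hη hU₀ hEbΩ s t (hcL0 s t hps hpt hs ht) (hcL1 s t hps hpt hs ht) hj hx
  have hE0 : ∀ s : lamSubK η U₀ L k Eb, (∀ (z : Site d) (i : Fin d), lamOf s (z + P • e i) = lamOf s z) → ‖s‖ ≤ α₄ / 4 → Bd2 L η k Ω (Eterm (lamOf s)) h₂ :=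
    fun s hp hs => hc2 s hp hs
  have hEL : ∀ s t : lamSubK η U₀ L k Eb, (∀ (z : Site d) (i : Fin d), lamOf s (z + P • e i) = lamOf s z) → (∀ (z : Site d) (i : Fin d), lamOf t (z + P • e i) = lamOf t z) →
      ‖s‖ ≤ α₄ / 4 → ‖t‖ ≤ α₄ / 4 → Bd2 L η k Ω (Eterm (lamOf s) - Eterm (lamOf t)) (l₂ * ‖s - t‖) :=
    fun s t hps hpt hs ht => hcL2 s t hps hpt hs ht
  -- exactly one periodic fixed point of the SOURCED contraction
  obtain ⟨s, -, -, -, huniq⟩ := propFive_fixedPoint_kLevel_src_per (Ω := Ω) (Eb := Eb) (U₀ := U₀) (A := A) (DA := fun y => covDivB η U₀ A y)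
    (f := f) hL hη P (⇑g) R gpar Eterm hα₄ hBG hBR (by positivity) ha₁' hb₁ hb₁' hcA hcA' hcDA hh₂ hl₂ (by positivity) (by positivity) hmf hθ hG
    (fun f f' => map_sub g f f') hGper hRsub hRbd hg0 hg1 hgL hE0 hEL hDA hf hA h103 h106
  have e₁ : t₁ = s := huniq t₁ hpt₁ ht₁ hfix₁
  have e₂ : t₂ = s := huniq t₂ hpt₂ ht₂ hfix₂
  rw [← hgp₁, ← hgp₂, e₁, e₂]


end Converse146B

#print axioms isFixedPoint_of_cond146_bdd_per
#print axioms hFP_unique_of_cond146_bdd_per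

end Literature.MathematicalPhysics.QuantumFieldTheory.Balaban1983to89.B8Prop5UniqKLevelBSrcPer

end
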